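import Mathlib
import Summits.ValiantsHypothesis.ValiantsHypothesis.Theorems.FifoMatchingNNDivisionHardHyperDegree
import Summits.ValiantsHypothesis.ValiantsHypothesis.Theorems.ZeroOneTransfer.Negative.TopComponentFree
import Literature.Computability.AlgebraicComplexity.NestFreeMatchingPoly
import HarnessLib

/-!
# Route FifoMatching — crux `NNDivisionHard` (stmt-ValiantsHypothesis-21181):
# the crux is its HOMOGENEOUS hyper-degree tier, by name

Refines `NNDivisionHard.HyperDegree.nnDivisionHard_iff_hyperDegree` (crux ⟺ cofactors of total
degree `> 2^⌊n^{1/8}⌋`): initial forms are free for monotone circuits over `ℝ≥0`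
(`ZeroOneTransfer.Negative.complexity_topComponent_le`, `topComponent_mul`), and `NN_n` is
homogeneous, so a certificate `(NN_n · h, h)` yields the no-costlier certificate
`(NN_n · top h, top h)` with `top h` the top-degree HOMOGENEOUS component of `h` (same total degree).
Hence

* `nnDivisionHard_iff_homogeneousHyperDegree` — `NNDivisionHard` ⟺ «for all `c`, eventually every
  nonzero HOMOGENEOUS cofactor `h` of degree `> 2^⌊n^{1/8}⌋` has
  `2^((log₂ n + c)^c) < L₊(NN_n · h) + L₊(h)`».

Honest framing: a by-name localisation of what is open in 21181, not progress on it;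
`NNDivisionHard`, `NNNotVP` and `VP ≠ VNP` stay OPEN (NOT proved).  No definitions, no named facts.
-/

noncomputable section

-- Sub = Summit single-conjunct layout: the duplicated namespace component is mandated by the tree.
set_option linter.dupNamespace false

namespace Summit.ValiantsHypothesis.ValiantsHypothesis.Theorems.FifoMatching.NNDivisionHard.HyperDegree

open MvPolynomial Literature.Computability.AlgebraicComplexity
open Summit.ValiantsHypothesis.ValiantsHypothesis.Theorems.ZeroOneTransfer.Negative
open scoped NNReal

/-- **Passing to the top-degree component of the cofactor costs nothing** (monotone circuits over
`ℝ≥0`, `NN_n` homogeneous): `L₊(NN_n · top h) ≤ L₊(NN_n · h)` and `L₊(top h) ≤ L₊(h)`. [folklore] -/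
theorem complexity_topComponent_cofactor_le (n : ℕ) (h : MvPolynomial (Fin (2 * n) × Fin (2 * n)) ℝ≥0) :
    complexity (nestFreeMatchingPoly n ℝ≥0 * topComponent (1 : Fin (2 * n) × Fin (2 * n) → ℕ) h) ≤
        complexity (nestFreeMatchingPoly n ℝ≥0 * h) ∧
      complexity (topComponent (1 : Fin (2 * n) × Fin (2 * n) → ℕ) h) ≤ complexity h := by
  refine ⟨?_, complexity_topComponent_le _ h⟩
  have hNN : topComponent (1 : Fin (2 * n) × Fin (2 * n) → ℕ) (nestFreeMatchingPoly n ℝ≥0) = nestFreeMatchingPoly n ℝ≥0 :=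
    topComponent_eq_self_of_isWeightedHomogeneous _ (nestFreeMatchingPoly_isHomogeneous n)
  have hmul : topComponent (1 : Fin (2 * n) × Fin (2 * n) → ℕ) (nestFreeMatchingPoly n ℝ≥0 * h) =
      nestFreeMatchingPoly n ℝ≥0 * topComponent (1 : Fin (2 * n) × Fin (2 * n) → ℕ) h := by
    rw [topComponent_mul, hNN]
  rw [← hmul]
  exact complexity_topComponent_le _ _

/-- The top-degree component of a nonzero `h` is nonzero, homogeneous, of the same total degree.
[folklore] -/
theorem topComponent_one_homogeneous {σ : Type*} (h : MvPolynomial σ ℝ≥0) (hh : h ≠ 0) :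
    topComponent (1 : σ → ℕ) h ≠ 0 ∧
      (topComponent (1 : σ → ℕ) h).IsHomogeneous (topComponent (1 : σ → ℕ) h).totalDegree ∧
      (topComponent (1 : σ → ℕ) h).totalDegree = h.totalDegree := by
  have hne : topComponent (1 : σ → ℕ) h ≠ 0 := topComponent_ne_zero _ hh
  have hhom : (topComponent (1 : σ → ℕ) h).IsHomogeneous h.totalDegree := by
    unfold topComponent
    rw [weightedTotalDegree_one]
    exact weightedHomogeneousComponent_isWeightedHomogeneous h.totalDegree h
  have hdeg : (topComponent (1 : σ → ℕ) h).totalDegree = h.totalDegree := hhom.totalDegree hne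
  exact ⟨hne, hdeg.symm ▸ hhom, hdeg⟩

/-- **`NNDivisionHard` ⟺ its homogeneous hyper-degree tier.**  What is OPEN in
stmt-ValiantsHypothesis-21181 is exactly: quasi-polynomial monotone certificates `L₊(NN_n · h) + L₊(h)`
with HOMOGENEOUS cofactors `h` of degree `> 2^⌊n^{1/8}⌋`. [folklore] -/
theorem nnDivisionHard_iff_homogeneousHyperDegree :
    Summit.ValiantsHypothesis.ValiantsHypothesis.Theses.FifoMatching.NNDivisionHard ↔
    ∀ c : ℕ, ∃ n₀ : ℕ, ∀ n ≥ n₀, ∀ h : MvPolynomial (Fin (2 * n) × Fin (2 * n)) ℝ≥0, h ≠ 0 →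
      h.IsHomogeneous h.totalDegree →
      2 ^ Nat.sqrt (Nat.sqrt (Nat.sqrt n)) < h.totalDegree →
        2 ^ ((Nat.log 2 n + c) ^ c) < complexity (nestFreeMatchingPoly n ℝ≥0 * h) + complexity h := by
  rw [nnDivisionHard_iff_hyperDegree]
  constructor
  · intro H c
    obtain ⟨n₀, hn₀⟩ := H c
    exact ⟨n₀, fun n hn h hh _ hd => hn₀ n hn h hh hd⟩
  · intro H c
    obtain ⟨n₀, hn₀⟩ := H c
    refine ⟨n₀, fun n hn h hh hd => ?_⟩
    obtain ⟨hne, hhom, hdeg⟩ := topComponent_one_homogeneous h hh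
    obtain ⟨h1, h2⟩ := complexity_topComponent_cofactor_le n h
    have hlt := hn₀ n hn _ hne hhom (by rw [hdeg]; exact hd)
    omega

end Summit.ValiantsHypothesis.ValiantsHypothesis.Theorems.FifoMatching.NNDivisionHard.HyperDegree

end
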